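import Summits.QuantumFields.YangMills.Theorems.BalabanUVNodesN11TransportOfRecordSeparated
import Summits.QuantumFields.YangMills.Theorems.BalabanUVNodesN11AveragingSkewPresentationAtRecord

/-!
# DAG node N11 — THE SEPARATED TRANSPORT OF RECORD AT def-R's REGIONS (`Y = (Ω_{k+1}(s))ᶜ`): the saturation binder `hY` DISCHARGED

HEADER — WORK-UNIT METADATA.  Cell `pub-ymgap`, YM-PLAN Track A (HUMAN RULING D-0062 ∕ D-0149), WIDTH SEAT `pub-ymgap-dag-n11-w2` (g3) on node
N11 [B14]; route `BalabanUVNodes`, key item K1⁷ `StabilityBAtRecordR13SepCoPH` = stmt-QuantumFields-20542 (helper, `--kind proof --supports 20542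
--as helper`, count-neutral).  [III] = [Balaban1988Convergent].  Sequel («v1.1 by sequel») of this seat's FILE 3 `…N11TransportOfRecordSeparated` (p614048),
worded by dag-n11-e g21 («YOURS — one declarer = you»): its three record theorems with the (0.4)-window saturation `hY` SUPPLIED by dag-n11-e's
`…N11AveragingSkewPresentationAtRecord.toFine_mem_compl_Omega_iff` (p615032) at the fine region of record `Y := (s.Ω (k+1))ᶜ` of a sequence of record `s`
(11a's `genDataOfRecord` choice: V-bonds `bondsIn k (Ω_{k+1})ᶜ`, image bonds `bondsIn (k+1) (Ω_{k+1})ᶜ`).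

WHAT THIS FILE PROVES (0 `def`, 0 `sorry`; only `hk : k+1 ≤ m+K`, `hkK : k < K` and the inner reading ∕ inner chart stay displayed):
* ★★★★ `transportOfRecord_comp_glue_ae_eq_kernelRTOfRecord_Omega` — at the exact bond sets of `(s.Ω (k+1))ᶜ`, inner reading displayed:
  `(transportOfRecord F N K k ρ) ∘ eα =ᵐ (V_out, r) ↦ kernelRTOfRecord F N K k sV sV' (y ↦ Fᵢ (y, r)) V_out`;
* ★★★★ `transportOfRecord_comp_glue_ae_eq_kernelRTOfRecord_of_innerChart_Omega` — the same with the inner fibre charted by dag-n11-d's socket on the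
  presented carriers (for any finsets `sV ∕ sV'` REPRESENTING the two bond sets, as 11a's `genDataOfRecord` lets `DecidableEq` choose them).

NOT IN THIS FILE: the inner chart ∕ Jacobian ((B4) concrete half), def-T's (†) ∕ (O3′)-left-side junction over the separated transport (dag-n11-d INTENT-5
`…N11TStepOfRecordSeparated`), K0b's re-pin, (S-β).

HONEST FRAMING.  Helper lane of K1⁷, count-neutral; one-line compositions BY NAME of p614048 with p615032; nothing of Bałaban's asserted; (B4) ∕ (S-α) NOT
closed; no registered stub proved; N11 NOT discharged; K1⁷ NOT closed; counts unmoved (typed 28∕28 · discharged 5∕27).  One finite four-torus programme at fixed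
`ε = L^{−K}`; R4 closes only the conditional finite-𝕋⁴ rung `BalabanLadder.UV` — NOT ℝ⁴, NOT OS, NOT a mass gap, NOT Clay.  No `sorry`, `axiom`, `def`,
`instance`, `notation`.  Sources (SHAPE only): [III] (2.1) p.254, (2.21) p.258, (3.1) p.264.
-/

noncomputable section

open MeasureTheory ProbabilityTheory Set Filter
open scoped ENNReal NNReal

namespace Summit.QuantumFields.YangMills.Theorems.BalabanUVNodesN11TransportOfRecordSeparatedOmega

open Literature.MathematicalPhysics.QuantumFieldTheory.Balaban1983to89
open T4AveragingDisintegration (kernelTransport)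
open T4Continuum Node00
open B10Eq42TorusConstraint (bondsIn)
open BalabanUVNodesN11TransportOfRecordSeparated (transportOfRecord_comp_glue_ae_eq_kernelRTOfRecord_bondsIn
  transportOfRecord_comp_glue_ae_eq_kernelRTOfRecord_of_innerChart)
open BalabanUVNodesN11AveragingSkewPresentationAtRecord (toFine_mem_compl_Omega_iff)

variable (F : T4Family) (N : ℕ) [NeZero N]

/-- ★★★★ **THE SEPARATED TRANSPORT OF RECORD AT `Y = (Ω_{k+1}(s))ᶜ` (inner reading displayed).**  For a sequence of record `s` (any length), a step `k < K`
with `k+1` in the standing range, an integrable density `ρ` and a displayed inner reading `hin` of the presented density at the bond sets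
`sV = bondsIn k (s.Ω (k+1))ᶜ`, `sV' = bondsIn (k+1) (s.Ω (k+1))ᶜ` (as finsets): `(transportOfRecord F N K k ρ) ∘ eα =ᵐ (V_out, r) ↦ kernelRTOfRecord F N K k sV sV'
(y ↦ Fᵢ (y, r)) V_out` — FILE 3's `_bondsIn` theorem with dag-n11-e's `toFine_mem_compl_Omega_iff` supplying the saturation of `(s.Ω (k+1))ᶜ`.
[cite: Balaban1988Convergent, (2.21) p.258, (3.1) p.264 (bookkeeping)] -/
theorem transportOfRecord_comp_glue_ae_eq_kernelRTOfRecord_Omega {ν : Stage7Numerics} {M : ℕ} {g : ℕ → ℝ} (K : ℕ) {n : ℕ}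
    (s : SeqOfRecord F ν M g K n) (k : ℕ) (hkK : k < K)
    [DecidableEq (PBond (F.P K) k)] [DecidableEq (PBond (F.P K) (k + 1))] (hk : k + 1 ≤ (F.P K).m + (F.P K).K)
    {ρ : Density (F.P K) k (SU N)} (hρ : Integrable ρ (fieldMeasure (F.P K) k (SU N)))
    {Fᵢ : (↥(Set.toFinite (bondsIn k (s.Ω (k + 1))ᶜ)).toFinset → SU N) ×
        ({c : PBond (F.P K) (k + 1) // c ∉ (Set.toFinite (bondsIn (k + 1) (s.Ω (k + 1))ᶜ)).toFinset} → SU N) → ℝ} (hFm : Measurable Fᵢ)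
    (hin : kernelTransport
        ((Measure.pi fun _ : ↥(Set.toFinite (bondsIn k (s.Ω (k + 1))ᶜ)).toFinset => (HaarData.haar : Measure (SU N))).prod
          (Measure.pi fun _ : {b : PBond (F.P K) k // b ∉ (Set.toFinite (bondsIn k (s.Ω (k + 1))ᶜ)).toFinset} =>
            (HaarData.haar : Measure (SU N))))
        ((Measure.pi fun _ : ↥(Set.toFinite (bondsIn k (s.Ω (k + 1))ᶜ)).toFinset => (HaarData.haar : Measure (SU N))).prod
          (Measure.pi fun _ : {c : PBond (F.P K) (k + 1) // c ∉ (Set.toFinite (bondsIn (k + 1) (s.Ω (k + 1))ᶜ)).toFinset} =>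
            (HaarData.haar : Measure (SU N))))
        (fun q => (q.1, fun c : {c : PBond (F.P K) (k + 1) // c ∉ (Set.toFinite (bondsIn (k + 1) (s.Ω (k + 1))ᶜ)).toFinset} =>
          (avOfRecord F N K k).avg
            ((MeasurableEquiv.piEquivPiSubtypeProd (fun _ : PBond (F.P K) k => SU N)
              (· ∈ (Set.toFinite (bondsIn k (s.Ω (k + 1))ᶜ)).toFinset)).symm q) c))
        (ρ ∘ ⇑(MeasurableEquiv.piEquivPiSubtypeProd (fun _ : PBond (F.P K) k => SU N)
          (· ∈ (Set.toFinite (bondsIn k (s.Ω (k + 1))ᶜ)).toFinset)).symm)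
      =ᵐ[(Measure.pi fun _ : ↥(Set.toFinite (bondsIn k (s.Ω (k + 1))ᶜ)).toFinset => (HaarData.haar : Measure (SU N))).prod
          (Measure.pi fun _ : {c : PBond (F.P K) (k + 1) // c ∉ (Set.toFinite (bondsIn (k + 1) (s.Ω (k + 1))ᶜ)).toFinset} =>
            (HaarData.haar : Measure (SU N)))] Fᵢ) :
    (transportOfRecord F N K k ρ) ∘
        ⇑(MeasurableEquiv.piEquivPiSubtypeProd (fun _ : PBond (F.P K) (k + 1) => SU N)
          (· ∈ (Set.toFinite (bondsIn (k + 1) (s.Ω (k + 1))ᶜ)).toFinset)).symm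
      =ᵐ[(Measure.pi fun _ : ↥(Set.toFinite (bondsIn (k + 1) (s.Ω (k + 1))ᶜ)).toFinset => (HaarData.haar : Measure (SU N))).prod
          (Measure.pi fun _ : {c : PBond (F.P K) (k + 1) // c ∉ (Set.toFinite (bondsIn (k + 1) (s.Ω (k + 1))ᶜ)).toFinset} =>
            (HaarData.haar : Measure (SU N)))]
        fun p => kernelRTOfRecord F N K k (Set.toFinite (bondsIn k (s.Ω (k + 1))ᶜ)).toFinset
          (Set.toFinite (bondsIn (k + 1) (s.Ω (k + 1))ᶜ)).toFinset (fun y => Fᵢ (y, p.2)) p.1 :=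
  transportOfRecord_comp_glue_ae_eq_kernelRTOfRecord_bondsIn F N K k hkK hk (toFine_mem_compl_Omega_iff s hk) hρ hFm hin

/-- ★★★★ **THE SEPARATED TRANSPORT OF RECORD AT `Y = (Ω_{k+1}(s))ᶜ`, INNER FIBRE CHARTED.**  For finsets `sV ∕ sV'` REPRESENTING `bondsIn k (s.Ω (k+1))ᶜ` ∕
`bondsIn (k+1) (s.Ω (k+1))ᶜ`, dag-n11-d's ⊗ₘκ socket for the inner step on the presented carriers (`κ`, `Ψ`, `J`, `S`, `hpush`, `hfib`) and an integrable measurable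
density whose presented density vanishes off `S`: `(transportOfRecord F N K k ρ) ∘ eα =ᵐ (V_out, r) ↦ kernelRTOfRecord F N K k sV sV'
[y ↦ ∫ J((y,r),x) · ρ (eβ (y, Ψ ((y,r),x))) ∂κ(y,r)] V_out` — only `hk`, `hkK` and the chart displayed. [cite: Balaban1988Convergent, (2.21) p.258, (3.1) p.264, (3.23)–(3.25) p.270 (bookkeeping)] -/
theorem transportOfRecord_comp_glue_ae_eq_kernelRTOfRecord_of_innerChart_Omega {ν : Stage7Numerics} {M : ℕ} {g : ℕ → ℝ} (K : ℕ) {n : ℕ}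
    (s : SeqOfRecord F ν M g K n) (k : ℕ) (hkK : k < K)
    [DecidableEq (PBond (F.P K) k)] [DecidableEq (PBond (F.P K) (k + 1))] (hk : k + 1 ≤ (F.P K).m + (F.P K).K)
    {sV : Finset (PBond (F.P K) k)} (hsV : ∀ b : PBond (F.P K) k, b ∈ sV ↔ b ∈ bondsIn k (s.Ω (k + 1))ᶜ)
    {sV' : Finset (PBond (F.P K) (k + 1))} (hsV' : ∀ c : PBond (F.P K) (k + 1), c ∈ sV' ↔ c ∈ bondsIn (k + 1) (s.Ω (k + 1))ᶜ)
    {X : Type*} [MeasurableSpace X]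
    {κ : Kernel ((↥sV → SU N) × ({c : PBond (F.P K) (k + 1) // c ∉ sV'} → SU N)) X} [IsSFiniteKernel κ]
    {Ψ : ((↥sV → SU N) × ({c : PBond (F.P K) (k + 1) // c ∉ sV'} → SU N)) × X → ({b : PBond (F.P K) k // b ∉ sV} → SU N)}
    (hΨ : Measurable Ψ)
    {J : ((↥sV → SU N) × ({c : PBond (F.P K) (k + 1) // c ∉ sV'} → SU N)) × X → ℝ≥0} (hJ : Measurable J)
    {S : Set ((↥sV → SU N) × ({b : PBond (F.P K) k // b ∉ sV} → SU N))}
    (hpush : ((((Measure.pi fun _ : ↥sV => (HaarData.haar : Measure (SU N))).prod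
          (Measure.pi fun _ : {c : PBond (F.P K) (k + 1) // c ∉ sV'} => (HaarData.haar : Measure (SU N)))) ⊗ₘ κ).withDensity
          (fun z => (J z : ℝ≥0∞))).map (fun z => (z.1.1, Ψ z))
      = ((Measure.pi fun _ : ↥sV => (HaarData.haar : Measure (SU N))).prod
          (Measure.pi fun _ : {b : PBond (F.P K) k // b ∉ sV} => (HaarData.haar : Measure (SU N)))).restrict S)
    (hfib : ∀ᵐ z ∂((((Measure.pi fun _ : ↥sV => (HaarData.haar : Measure (SU N))).prod
          (Measure.pi fun _ : {c : PBond (F.P K) (k + 1) // c ∉ sV'} => (HaarData.haar : Measure (SU N)))) ⊗ₘ κ).withDensity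
          (fun z => (J z : ℝ≥0∞))),
      (fun c : {c : PBond (F.P K) (k + 1) // c ∉ sV'} =>
        (avOfRecord F N K k).avg ((MeasurableEquiv.piEquivPiSubtypeProd (fun _ : PBond (F.P K) k => SU N) (· ∈ sV)).symm
          (z.1.1, Ψ z)) c) = z.1.2)
    {ρ : Density (F.P K) k (SU N)} (hρm : Measurable ρ) (hρ : Integrable ρ (fieldMeasure (F.P K) k (SU N)))
    (hρS : ∀ q, q ∉ S → ρ ((MeasurableEquiv.piEquivPiSubtypeProd (fun _ : PBond (F.P K) k => SU N) (· ∈ sV)).symm q) = 0) :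
    (transportOfRecord F N K k ρ) ∘ ⇑(MeasurableEquiv.piEquivPiSubtypeProd (fun _ : PBond (F.P K) (k + 1) => SU N) (· ∈ sV')).symm
      =ᵐ[(Measure.pi fun _ : ↥sV' => (HaarData.haar : Measure (SU N))).prod
          (Measure.pi fun _ : {c : PBond (F.P K) (k + 1) // c ∉ sV'} => (HaarData.haar : Measure (SU N)))]
        fun v => kernelRTOfRecord F N K k sV sV'
          (fun y => ∫ x, (J ((y, v.2), x) : ℝ) *
            ρ ((MeasurableEquiv.piEquivPiSubtypeProd (fun _ : PBond (F.P K) k => SU N) (· ∈ sV)).symm (y, Ψ ((y, v.2), x))) ∂(κ (y, v.2)))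
          v.1 :=
  transportOfRecord_comp_glue_ae_eq_kernelRTOfRecord_of_innerChart F N K k hkK hk (toFine_mem_compl_Omega_iff s hk) hsV hsV'
    hΨ hJ hpush hfib hρm hρ hρS

end Summit.QuantumFields.YangMills.Theorems.BalabanUVNodesN11TransportOfRecordSeparatedOmega
end
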